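import Summits.QuantumFields.YangMills.Theorems.LangevinControlUVOSLegsFromFemtoAndGapStubLowerTwoPointMain
import Summits.QuantumFields.YangMills.Theorems.LangevinControlUVOSLegsFromFemtoAndGapStubLowerThreePointMain

/-!
# Stub `stub_lower` of line `dlr-collar-transfer` (crux `OSLegsFromFemtoAndGap`, stmt-QuantumFields-9367)

`theorem stub_lower : Statement.stub_lower` — the registered stub **CollarLowerBounds** of the skeleton
`Cruxes/OSLegsFromFemtoAndGap/Lines/dlr_collar_transfer.lean`:

  `∀ G r a, (∀ β, 0 < a β) → a → 0 → FBL G r a → FC2 G r a → FC3 G r a → LowerBounds G r a`.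

Femto conditional lower bounds ⇒ `k`-free lattice lower bounds on every large torus: the law of total
covariance / cumulance through ONE femto cube containing the insertion regions (torus DLR equation of the
tree, `wilsonExpectation_toTorusObservable_eq`, in window form), FC2's conditional covariance floor and
FC3's signed conditional cumulant floor for every exterior, FBL's `C₁/d⁴` boundary law at a depth chosen
inside the growth clauses (`Γ(s)/s⁸ → ∞`, `Γ₃(s)/s⁴ → ∞`, `s K(s) → 0`), bump test functions and the
Riemann mass of their plateaux.  The two conjuncts are `StubLower.lowerBounds_twoPoint`
(`…StubLowerTwoPointMain.lean`) and `StubLower.lowerBounds_threePoint` (`…StubLowerThreePointMain.lean`).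
-/

set_option autoImplicit false

namespace Summit.QuantumFields.YangMills.Cruxes.OSLegsFromFemtoAndGap.DlrCollarTransfer

/-- Registered stub `stub_lower` (**CollarLowerBounds**): femto conditional lower bounds (FBL, FC2, FC3)
for a unit map `a > 0`, `a → 0` give the `k`-free lattice lower bounds `LowerBounds` — a positive-time
bump `v` with `Q2(θv, v) ≥ ε > 0` and three disjointly supported bumps with `|Q3(f, g, h)| ≥ ε` on every
large torus at every large coupling. [folklore] -/
theorem stub_lower : Statement.stub_lower := by
  intro G _ _ _ _ _ _ r a hapos hlim hFBL hFC2 hFC3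
  exact ⟨StubLower.lowerBounds_twoPoint G r a hapos hlim hFBL hFC2,
    StubLower.lowerBounds_threePoint G r a hapos hlim hFBL hFC2 hFC3⟩

end Summit.QuantumFields.YangMills.Cruxes.OSLegsFromFemtoAndGap.DlrCollarTransfer
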